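import Literature.MathematicalPhysics.QuantumFieldTheory.Balaban1983to89.B9SectBL2DictionaryY
import Literature.MathematicalPhysics.QuantumFieldTheory.Balaban1983to89.B9SectBL2StepAtLettersV2Second
import Literature.MathematicalPhysics.QuantumFieldTheory.Balaban1983to89.B9SectBL2StepAtLettersV2Mixed
import Literature.MathematicalPhysics.QuantumFieldTheory.Balaban1983to89.B9GeoNormsKLevelModelSignsV1

/-!
# `Balaban1983to89.B9SectBL2StepCodedOn` — the POSITIVE-INPUT (3.46) BLOCK-STEPS `StepL2nPos` (members 0–5) and `StepL2Pos` of the coded family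
# `KSC₃` on a subfamily, kernel-free from the letters-level frames (pub-ymgap N06 row 13, (O4) per-member programme, `L²` member, StepPos currency)

T. Bałaban, *Propagators for lattice gauge theories in a background field*, Commun. Math. Phys. **99** (1985) 389–434
[`Balaban1985BackgroundPropagators`, "B9"]; [4] = T. Bałaban, *Propagators and renormalization transformations for lattice gauge
theories. II*, Commun. Math. Phys. **96** (1984) 223–250 [`Balaban1984PropagatorsII`].

statement-level skeleton of published theorems with citation tags; proofs where landed; nothing here is a claim about the
Yang–Mills mass gap

THE PRINTED LOCI.  Theorem 3.1 (3.46) p. 398 (the six `L²` entries); Theorem 3.4 p. 400 and Sect. B pp. 400–407 (the extension `U ↦ U′U` «with the same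
constants»); p. 403 l.1–9; (3.63)–(3.67) pp. 402–403; [4] Prop. 2.6 (2.140)–(2.141) p. 247, Lemma 2.1 p. 234.

WHY THIS FILE (seat dag-n06-c gen 9; interface word of the chain owner dag-n06-d g10, 2026-08-28: «StepPos currency»).  The certificate's row 13 is knit
from POSITIVE-INPUT block-steps `B9SectBStepWhole.StepXPos` (`sectBStepPrinted_of_posBlockSteps`).  For the (3.46) member the letters-level frames
deliver `StepL2nPos … n` for every member `n` of any family carrying an `L2Frame₂` plus the six further read/write fields
(`B9SectBL2StepAtLettersV2(.Right/.Second/.Mixed).stepL2nPos_*_of_l2Frame₂`).  `B9SectBL2DictionaryY` inhabits that frame over the CODED carriers of a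
subfamily at the augmented readings `KSC₃` (`l2Frame₂CodedOn`) and types the six fields in their literal shapes (`readL2_two … writeL2_five_KSC₃`, all
tautological for augmented readings).  This file plugs them: ★★ `stepL2nPos_KSC₃_on n` for `n = 0, …, 5` and ★★ `stepL2Pos_KSC₃_on` — the (3.46)
positive-input step of `KSC₃` over the coded carrier, all six members, any `GA`, `Cinv`.  Its transport to the record's own family (the Step-level
`hin`/`hout` of `B9SectBL2SecondOrderY` / `B9SectBCodedChainL2`) is the successor item.
Value = plumbing of landed frames; NOT summit progress; N06 is not discharged by this file.
-/

noncomputable section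

namespace Literature.MathematicalPhysics.QuantumFieldTheory.Balaban1983to89.B9SectBL2StepCodedOn

open Literature.MathematicalPhysics.QuantumFieldTheory.Balaban1983to89
open Literature.MathematicalPhysics.QuantumFieldTheory.Balaban1983to89.B6Ineq2142KLevelV1 (β)
open Literature.MathematicalPhysics.QuantumFieldTheory.Balaban1983to89.B9Eq360DeltaPrimeAY (AfldY)
open Literature.MathematicalPhysics.QuantumFieldTheory.Balaban1983to89.B9PinMembersKLevelV1 (MemberY geo9Y bg9Y)
open Literature.MathematicalPhysics.QuantumFieldTheory.Balaban1983to89.B9SectBGpLettersY (GVal)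
open Literature.MathematicalPhysics.QuantumFieldTheory.Balaban1983to89.B9SectBGpFrameCodedY (codingYx CplxLettersY)
open Literature.MathematicalPhysics.QuantumFieldTheory.Balaban1983to89.B9SectBL2DictionaryY (KSC₃ l2Frame₂CodedOn readL2_two_KSC₃ readL2_three_KSC₃
  readL2_four_KSC₃ readL2_five_KSC₃ writeL2_two_KSC₃ writeL2_three_KSC₃ writeL2_four_KSC₃ writeL2_five_KSC₃)
open Literature.MathematicalPhysics.QuantumFieldTheory.Balaban1983to89.B9SectBStepWhole (StepL2nPos StepL2Pos stepL2Pos_of_members)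
open Literature.MathematicalPhysics.QuantumFieldTheory.Balaban1983to89.B9GeoNormsKLevelModelSignsV1 (modelSignsOn_geo9K)
open Literature.MathematicalPhysics.QuantumFieldTheory.Balaban1983to89.Node00 (SiteY BlkY IBondY CfgY SiteParY)

variable {d ℓ : ℕ} {hd : 1 ≤ d + 1} {hL : Odd (ℓ + 1) ∧ 1 < ℓ + 1} {b₀ b₁ : ℝ} {Mstar : ℕ}
variable {𝔸 : Type} [NormedRing 𝔸] [NormedAlgebra ℂ 𝔸] [CompleteSpace 𝔸] [NormOneClass 𝔸] [FiniteDimensional ℝ 𝔸]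

variable {J : Type} (f : J → MemberY d ℓ hd hL b₀ b₁ Mstar)
  (c35 : ℝ) (G : Subgroup 𝔸ˣ) {ι : Type} [Fintype ι] [DecidableEq ι] (b : Module.Basis ι ℝ 𝔸)
  [∀ x : MemberY d ℓ hd hL b₀ b₁ Mstar, Fintype (geo9Y x).Site] [∀ x : MemberY d ℓ hd hL b₀ b₁ Mstar, DecidableEq (geo9Y x).Site]
  [∀ x : MemberY d ℓ hd hL b₀ b₁ Mstar, Nonempty (geo9Y x).Site]
  (C37 C38 : ∀ j : J, ℝ → CfgY 𝔸 (f j).toKIdx → AfldY 𝔸 (f j).toKIdx → Prop)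
  (par : ∀ j : J, SiteParY 𝔸 (f j).toKIdx)
  (ιB : ∀ j : J, BlkY (f j).toKIdx → IBondY (f j).toKIdx)

/-- ★★ **THE POSITIVE-INPUT (3.46) BLOCK-STEP OF `KSC₃`, MEMBER BY MEMBER, ON A SUBFAMILY** (all six members), from the letters-level frames over the
coded carrier (`l2Frame₂CodedOn`) and the six tautological read/write fields of the augmented readings; any `GA`, `Cinv`.
[cite: Balaban1985BackgroundPropagators, Thm 3.1 (3.46) p.398, Thm 3.4 p.400, (3.63)–(3.67) pp.402–403, p.403 l.1–9; Balaban1984PropagatorsII, Prop. 2.6 (2.140)–(2.141) p.247, Lemma 2.1 p.234] -/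
theorem stepL2nPos_KSC₃_on (hι : ∀ (j : J) (s : BlkY (f j).toKIdx), β (f j).toKIdx.hN (f j).toKIdx.D (f j).toKIdx.hk (ιB j s) = s)
    (hG1 : ∀ u : 𝔸ˣ, u ∈ G → ‖(u : 𝔸)‖ ≤ 1) (hpar : ∀ j (U : CfgY 𝔸 (f j).toKIdx), GVal G (f j).toKIdx U → ∀ z w, par j U z w ∈ G)
    (hunit : ∀ j (U : CfgY 𝔸 (f j).toKIdx), GVal G (f j).toKIdx U → IsUnit (Node00.deltaPrimeAY (f j).toKIdx (par j) U))
    (dB : ℕ) (M₂ : ℝ) (hM₂ : 0 ≤ M₂) (hrepr : ∀ (v : 𝔸) (j : ι), |b.repr v j| ≤ M₂ * ‖v‖) (hcR : 0 < M₂ * ∑ j, ‖b j‖)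
    (hcL : 0 < Real.sqrt (Fintype.card ι) * M₂ * ∑ j, ‖b j‖)
    (Cq : ℝ) (hCq : 0 ≤ Cq) (hC37 : ∀ j β' U a, C37 j β' U a → GVal G (f j).toKIdx U ∧ CplxLettersY G (f j) (par j) (ιB j) Cq β' U a)
    (MInv aInv aW : ℝ) (hMInv : 0 < MInv) (haInv : 0 < aInv) (haW : 0 < aW)
    (GA : ∀ j : J, B9.KernelFamily (geo9Y (f j)) (codingYx G (f j) (C37 j) (C38 j)).bg)
    (Cinv : ∀ j : J, B9.SiteKernel (geo9Y (f j)) (codingYx G (f j) (C37 j) (C38 j)).bg) (n : Fin 6) :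
    StepL2nPos dB c35 (fun j => geo9Y (f j)) (fun j => (codingYx G (f j) (C37 j) (C38 j)).bg) (fun j => KSC₃ G (f j) (par j) (C37 j) (C38 j)) GA Cinv
      (fun j => KSC₃ G (f j) (par j) (C37 j) (C38 j)) n := by
  set F := l2Frame₂CodedOn f c35 G b C37 C38 par ιB hι hG1 hpar hunit dB M₂ hM₂ hrepr hcR hcL Cq hCq hC37 MInv aInv aW hMInv haInv haW with hF
  -- the six tautological fields of the augmented readings, in the frames' binder shapes
  have r2 : ∀ j (α₀ : ℝ) (c : (codingYx G (f j) (C37 j) (C38 j)).bg.Cfg) (B₀ δ : ℝ), F.MInv ≤ (geo9Y (f j)).M → 0 < α₀ → (geo9Y (f j)).M * α₀ ≤ F.aInv →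
      (codingYx G (f j) (C37 j) (C38 j)).bg.Reg335 c35 α₀ c → 0 < B₀ → 0 < δ → B9FromB6.L2Block (KSC₃ G (f j) (par j) (C37 j) (C38 j)) B₀ δ c →
      ∀ k : Fin (d + 1) ⊕ Fin (d + 1), B6RandomWalkL2.HasL2Majorant (g := B9Thm34Ext.toB6 (geo9Y (f j)) (F.Rr j) (F.Hp j))
        (fun p : SiteY (f j).toKIdx × ι => F.blk j p.1)
        (F.Gop j c * B9Eq352DivFormLetters.conj b (B9Eq352GradLetters.diffLetter (F.T j) (F.coord j c) ((((geo9Y (f j)).eta : ℂ))⁻¹) k))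
        (fun a a' => F.cL * B₀ * (geo9Y (f j)).len a * Real.exp (-(δ * (geo9Y (f j)).dist a a'))) := by
    intro j α₀ c B₀ δ _ _ _ hreg hB₀ _ hL2 k
    obtain ⟨U, rfl, hU⟩ := (codingYx G (f j) (C37 j) (C38 j)).exists_of_bg_Reg335 hreg
    exact readL2_two_KSC₃ G (f j) (par j) (C37 j) (C38 j) b (ιB j) (hι j) hM₂ hrepr hU.1.1 hB₀.le hL2 k
  have r3 : ∀ j (α₀ : ℝ) (c : (codingYx G (f j) (C37 j) (C38 j)).bg.Cfg) (B₀ δ : ℝ), F.MInv ≤ (geo9Y (f j)).M → 0 < α₀ → (geo9Y (f j)).M * α₀ ≤ F.aInv →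
      (codingYx G (f j) (C37 j) (C38 j)).bg.Reg335 c35 α₀ c → 0 < B₀ → 0 < δ → B9FromB6.L2Block (KSC₃ G (f j) (par j) (C37 j) (C38 j)) B₀ δ c →
      ∀ k l : Fin (d + 1) ⊕ Fin (d + 1), B6RandomWalkL2.HasL2Majorant (g := B9Thm34Ext.toB6 (geo9Y (f j)) (F.Rr j) (F.Hp j))
        (fun p : SiteY (f j).toKIdx × ι => F.blk j p.1)
        (B9Eq352DivFormLetters.conj b (B9Eq352GradLetters.diffLetter (F.T j) (F.coord j c) ((((geo9Y (f j)).eta : ℂ))⁻¹) k) *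
          B9Eq352DivFormLetters.conj b (B9Eq352GradLetters.diffLetter (F.T j) (F.coord j c) ((((geo9Y (f j)).eta : ℂ))⁻¹) l) * F.Gop j c)
        (fun a a' => F.cL * B₀ * 1 * Real.exp (-(δ * (geo9Y (f j)).dist a a'))) := by
    intro j α₀ c B₀ δ _ _ _ hreg hB₀ _ hL2 k l
    obtain ⟨U, rfl, hU⟩ := (codingYx G (f j) (C37 j) (C38 j)).exists_of_bg_Reg335 hreg
    exact readL2_three_KSC₃ G (f j) (par j) (C37 j) (C38 j) b (ιB j) (hι j) hM₂ hrepr hU.1.1 hB₀.le hL2 k l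
  have r4 : ∀ j (α₀ : ℝ) (c : (codingYx G (f j) (C37 j) (C38 j)).bg.Cfg) (B₀ δ : ℝ), F.MInv ≤ (geo9Y (f j)).M → 0 < α₀ → (geo9Y (f j)).M * α₀ ≤ F.aInv →
      (codingYx G (f j) (C37 j) (C38 j)).bg.Reg335 c35 α₀ c → 0 < B₀ → 0 < δ → B9FromB6.L2Block (KSC₃ G (f j) (par j) (C37 j) (C38 j)) B₀ δ c →
      ∀ k l : Fin (d + 1) ⊕ Fin (d + 1), B6RandomWalkL2.HasL2Majorant (g := B9Thm34Ext.toB6 (geo9Y (f j)) (F.Rr j) (F.Hp j))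
        (fun p : SiteY (f j).toKIdx × ι => F.blk j p.1)
        (B9Eq352DivFormLetters.conj b (B9Eq352GradLetters.diffLetter (F.T j) (F.coord j c) ((((geo9Y (f j)).eta : ℂ))⁻¹) k) * F.Gop j c *
          B9Eq352DivFormLetters.conj b (B9Eq352GradLetters.diffLetter (F.T j) (F.coord j c) ((((geo9Y (f j)).eta : ℂ))⁻¹) l))
        (fun a a' => F.cL * B₀ * 1 * Real.exp (-(δ * (geo9Y (f j)).dist a a'))) := by
    intro j α₀ c B₀ δ _ _ _ hreg hB₀ _ hL2 k l
    obtain ⟨U, rfl, hU⟩ := (codingYx G (f j) (C37 j) (C38 j)).exists_of_bg_Reg335 hreg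
    exact readL2_four_KSC₃ G (f j) (par j) (C37 j) (C38 j) b (ιB j) (hι j) hM₂ hrepr hU.1.1 hB₀.le hL2 k l
  have r5 : ∀ j (α₀ : ℝ) (c : (codingYx G (f j) (C37 j) (C38 j)).bg.Cfg) (B₀ δ : ℝ), F.MInv ≤ (geo9Y (f j)).M → 0 < α₀ → (geo9Y (f j)).M * α₀ ≤ F.aInv →
      (codingYx G (f j) (C37 j) (C38 j)).bg.Reg335 c35 α₀ c → 0 < B₀ → 0 < δ → B9FromB6.L2Block (KSC₃ G (f j) (par j) (C37 j) (C38 j)) B₀ δ c →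
      ∀ k l : Fin (d + 1) ⊕ Fin (d + 1), B6RandomWalkL2.HasL2Majorant (g := B9Thm34Ext.toB6 (geo9Y (f j)) (F.Rr j) (F.Hp j))
        (fun p : SiteY (f j).toKIdx × ι => F.blk j p.1)
        (F.Gop j c * B9Eq352DivFormLetters.conj b (B9Eq352GradLetters.diffLetter (F.T j) (F.coord j c) ((((geo9Y (f j)).eta : ℂ))⁻¹) k) *
          B9Eq352DivFormLetters.conj b (B9Eq352GradLetters.diffLetter (F.T j) (F.coord j c) ((((geo9Y (f j)).eta : ℂ))⁻¹) l))
        (fun a a' => F.cL * B₀ * 1 * Real.exp (-(δ * (geo9Y (f j)).dist a a'))) := by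
    intro j α₀ c B₀ δ _ _ _ hreg hB₀ _ hL2 k l
    obtain ⟨U, rfl, hU⟩ := (codingYx G (f j) (C37 j) (C38 j)).exists_of_bg_Reg335 hreg
    exact readL2_five_KSC₃ G (f j) (par j) (C37 j) (C38 j) b (ιB j) (hι j) hM₂ hrepr hU.1.1 hB₀.le hL2 k l
  have w2 : ∀ j (c c' : (codingYx G (f j) (C37 j) (C38 j)).bg.Cfg) (α₁ B δ : ℝ), 0 < α₁ → α₁ ≤ F.aW →
      (codingYx G (f j) (C37 j) (C38 j)).bg.Cplx337 α₁ c c' → 0 ≤ B → 0 < δ →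
      (∀ k : Fin (d + 1) ⊕ Fin (d + 1), B6RandomWalkL2.HasL2Majorant (g := B9Thm34Ext.toB6 (geo9Y (f j)) (F.Rr j) (F.Hp j))
          (fun p : SiteY (f j).toKIdx × ι => F.blk j p.1)
          (F.Gop j ((codingYx G (f j) (C37 j) (C38 j)).bg.mul c' c) *
            B9Eq352DivFormLetters.conj b (B9Eq352GradLetters.diffLetter (F.T j) (F.coord j c) ((((geo9Y (f j)).eta : ℂ))⁻¹) k))
          (fun a a' => B * (geo9Y (f j)).len a * Real.exp (-(δ * (geo9Y (f j)).dist a a')))) →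
      ∀ (lam : (geo9Y (f j)).Loc) (h : (geo9Y (f j)).Cut) (y y' : (geo9Y (f j)).Site), (geo9Y (f j)).cutIn h y → (geo9Y (f j)).suppIn lam y' →
        (KSC₃ G (f j) (par j) (C37 j) (C38 j)).l2 2 ((codingYx G (f j) (C37 j) (C38 j)).bg.mul c' c) lam h ≤
          F.wL B δ * B9.pref6 ((geo9Y (f j)).len y) 2 * (geo9Y (f j)).cutSup h * Real.exp (-(F.wLδ δ * (geo9Y (f j)).dist y y')) *
            (geo9Y (f j)).l2Norm lam := by
    intro j c c' α₁ B δ _ _ h37 hB _ hG lam h y y' hc hs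
    obtain ⟨U, a, rfl, rfl, hC⟩ := (codingYx G (f j) (C37 j) (C38 j)).exists_of_bg_Cplx337 h37
    exact writeL2_two_KSC₃ G (f j) (par j) (C37 j) (C38 j) b (ιB j) (hι j) hM₂ hrepr (hC37 j _ U a hC).1 a hB hG lam h y y' hc hs
  have w3 : ∀ j (c c' : (codingYx G (f j) (C37 j) (C38 j)).bg.Cfg) (α₁ B δ : ℝ), 0 < α₁ → α₁ ≤ F.aW →
      (codingYx G (f j) (C37 j) (C38 j)).bg.Cplx337 α₁ c c' → 0 ≤ B → 0 < δ →
      (∀ k l : Fin (d + 1) ⊕ Fin (d + 1), B6RandomWalkL2.HasL2Majorant (g := B9Thm34Ext.toB6 (geo9Y (f j)) (F.Rr j) (F.Hp j))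
          (fun p : SiteY (f j).toKIdx × ι => F.blk j p.1)
          (B9Eq352DivFormLetters.conj b (B9Eq352GradLetters.diffLetter (F.T j) (F.coord j c) ((((geo9Y (f j)).eta : ℂ))⁻¹) k) *
            B9Eq352DivFormLetters.conj b (B9Eq352GradLetters.diffLetter (F.T j) (F.coord j c) ((((geo9Y (f j)).eta : ℂ))⁻¹) l) *
            F.Gop j ((codingYx G (f j) (C37 j) (C38 j)).bg.mul c' c))
          (fun a a' => B * 1 * Real.exp (-(δ * (geo9Y (f j)).dist a a')))) →
      ∀ (lam : (geo9Y (f j)).Loc) (h : (geo9Y (f j)).Cut) (y y' : (geo9Y (f j)).Site), (geo9Y (f j)).cutIn h y → (geo9Y (f j)).suppIn lam y' →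
        (KSC₃ G (f j) (par j) (C37 j) (C38 j)).l2 3 ((codingYx G (f j) (C37 j) (C38 j)).bg.mul c' c) lam h ≤
          F.wL B δ * B9.pref6 ((geo9Y (f j)).len y) 3 * (geo9Y (f j)).cutSup h * Real.exp (-(F.wLδ δ * (geo9Y (f j)).dist y y')) *
            (geo9Y (f j)).l2Norm lam := by
    intro j c c' α₁ B δ _ _ h37 hB _ hG lam h y y' hc hs
    obtain ⟨U, a, rfl, rfl, hC⟩ := (codingYx G (f j) (C37 j) (C38 j)).exists_of_bg_Cplx337 h37
    exact writeL2_three_KSC₃ G (f j) (par j) (C37 j) (C38 j) b (ιB j) (hι j) hM₂ hrepr (hC37 j _ U a hC).1 a hB hG lam h y y' hc hs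
  have w4 : ∀ j (c c' : (codingYx G (f j) (C37 j) (C38 j)).bg.Cfg) (α₁ B δ : ℝ), 0 < α₁ → α₁ ≤ F.aW →
      (codingYx G (f j) (C37 j) (C38 j)).bg.Cplx337 α₁ c c' → 0 ≤ B → 0 < δ →
      (∀ k l : Fin (d + 1) ⊕ Fin (d + 1), B6RandomWalkL2.HasL2Majorant (g := B9Thm34Ext.toB6 (geo9Y (f j)) (F.Rr j) (F.Hp j))
          (fun p : SiteY (f j).toKIdx × ι => F.blk j p.1)
          (B9Eq352DivFormLetters.conj b (B9Eq352GradLetters.diffLetter (F.T j) (F.coord j c) ((((geo9Y (f j)).eta : ℂ))⁻¹) k) *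
            F.Gop j ((codingYx G (f j) (C37 j) (C38 j)).bg.mul c' c) *
            B9Eq352DivFormLetters.conj b (B9Eq352GradLetters.diffLetter (F.T j) (F.coord j c) ((((geo9Y (f j)).eta : ℂ))⁻¹) l))
          (fun a a' => B * 1 * Real.exp (-(δ * (geo9Y (f j)).dist a a')))) →
      ∀ (lam : (geo9Y (f j)).Loc) (h : (geo9Y (f j)).Cut) (y y' : (geo9Y (f j)).Site), (geo9Y (f j)).cutIn h y → (geo9Y (f j)).suppIn lam y' →
        (KSC₃ G (f j) (par j) (C37 j) (C38 j)).l2 4 ((codingYx G (f j) (C37 j) (C38 j)).bg.mul c' c) lam h ≤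
          F.wL B δ * B9.pref6 ((geo9Y (f j)).len y) 4 * (geo9Y (f j)).cutSup h * Real.exp (-(F.wLδ δ * (geo9Y (f j)).dist y y')) *
            (geo9Y (f j)).l2Norm lam := by
    intro j c c' α₁ B δ _ _ h37 hB _ hG lam h y y' hc hs
    obtain ⟨U, a, rfl, rfl, hC⟩ := (codingYx G (f j) (C37 j) (C38 j)).exists_of_bg_Cplx337 h37
    exact writeL2_four_KSC₃ G (f j) (par j) (C37 j) (C38 j) b (ιB j) (hι j) hM₂ hrepr (hC37 j _ U a hC).1 a hB hG lam h y y' hc hs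
  have w5 : ∀ j (c c' : (codingYx G (f j) (C37 j) (C38 j)).bg.Cfg) (α₁ B δ : ℝ), 0 < α₁ → α₁ ≤ F.aW →
      (codingYx G (f j) (C37 j) (C38 j)).bg.Cplx337 α₁ c c' → 0 ≤ B → 0 < δ →
      (∀ k l : Fin (d + 1) ⊕ Fin (d + 1), B6RandomWalkL2.HasL2Majorant (g := B9Thm34Ext.toB6 (geo9Y (f j)) (F.Rr j) (F.Hp j))
          (fun p : SiteY (f j).toKIdx × ι => F.blk j p.1)
          (F.Gop j ((codingYx G (f j) (C37 j) (C38 j)).bg.mul c' c) *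
            B9Eq352DivFormLetters.conj b (B9Eq352GradLetters.diffLetter (F.T j) (F.coord j c) ((((geo9Y (f j)).eta : ℂ))⁻¹) k) *
            B9Eq352DivFormLetters.conj b (B9Eq352GradLetters.diffLetter (F.T j) (F.coord j c) ((((geo9Y (f j)).eta : ℂ))⁻¹) l))
          (fun a a' => B * 1 * Real.exp (-(δ * (geo9Y (f j)).dist a a')))) →
      ∀ (lam : (geo9Y (f j)).Loc) (h : (geo9Y (f j)).Cut) (y y' : (geo9Y (f j)).Site), (geo9Y (f j)).cutIn h y → (geo9Y (f j)).suppIn lam y' →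
        (KSC₃ G (f j) (par j) (C37 j) (C38 j)).l2 5 ((codingYx G (f j) (C37 j) (C38 j)).bg.mul c' c) lam h ≤
          F.wL B δ * B9.pref6 ((geo9Y (f j)).len y) 5 * (geo9Y (f j)).cutSup h * Real.exp (-(F.wLδ δ * (geo9Y (f j)).dist y y')) *
            (geo9Y (f j)).l2Norm lam := by
    intro j c c' α₁ B δ _ _ h37 hB _ hG lam h y y' hc hs
    obtain ⟨U, a, rfl, rfl, hC⟩ := (codingYx G (f j) (C37 j) (C38 j)).exists_of_bg_Cplx337 h37
    exact writeL2_five_KSC₃ G (f j) (par j) (C37 j) (C38 j) b (ιB j) (hι j) hM₂ hrepr (hC37 j _ U a hC).1 a hB hG lam h y y' hc hs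
  match n with
  | 0 => exact B9SectBL2StepAtLettersV2.stepL2nPos_zero_of_l2Frame₂ F GA Cinv
  | 1 => exact B9SectBL2StepAtLettersV2.stepL2nPos_one_of_l2Frame₂ F GA Cinv
  | 2 => exact B9SectBL2StepAtLettersV2Right.stepL2nPos_two_of_l2Frame₂ F r2 w2 GA Cinv
  | 3 => exact B9SectBL2StepAtLettersV2Second.stepL2nPos_three_of_l2Frame₂ F r3 w3 GA Cinv
  | 4 => exact B9SectBL2StepAtLettersV2Mixed.stepL2nPos_four_of_l2Frame₂ F r2 r4 w4 GA Cinv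
  | 5 => exact B9SectBL2StepAtLettersV2Second.stepL2nPos_five_of_l2Frame₂ F r2 r5 w5 GA Cinv

/-- ★★ **THE POSITIVE-INPUT (3.46) BLOCK-STEP `StepL2Pos` OF `KSC₃` ON A SUBFAMILY** (the six members assembled by `B9SectBStepWhole.stepL2Pos_of_members` at
the model signs of the record geometry). [cite: Balaban1985BackgroundPropagators, Thm 3.1 (3.46) p.398, Thm 3.4 p.400, p.403 l.1–9] -/
theorem stepL2Pos_KSC₃_on (hι : ∀ (j : J) (s : BlkY (f j).toKIdx), β (f j).toKIdx.hN (f j).toKIdx.D (f j).toKIdx.hk (ιB j s) = s)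
    (hG1 : ∀ u : 𝔸ˣ, u ∈ G → ‖(u : 𝔸)‖ ≤ 1) (hpar : ∀ j (U : CfgY 𝔸 (f j).toKIdx), GVal G (f j).toKIdx U → ∀ z w, par j U z w ∈ G)
    (hunit : ∀ j (U : CfgY 𝔸 (f j).toKIdx), GVal G (f j).toKIdx U → IsUnit (Node00.deltaPrimeAY (f j).toKIdx (par j) U))
    (dB : ℕ) (M₂ : ℝ) (hM₂ : 0 ≤ M₂) (hrepr : ∀ (v : 𝔸) (j : ι), |b.repr v j| ≤ M₂ * ‖v‖) (hcR : 0 < M₂ * ∑ j, ‖b j‖)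
    (hcL : 0 < Real.sqrt (Fintype.card ι) * M₂ * ∑ j, ‖b j‖)
    (Cq : ℝ) (hCq : 0 ≤ Cq) (hC37 : ∀ j β' U a, C37 j β' U a → GVal G (f j).toKIdx U ∧ CplxLettersY G (f j) (par j) (ιB j) Cq β' U a)
    (MInv aInv aW : ℝ) (hMInv : 0 < MInv) (haInv : 0 < aInv) (haW : 0 < aW)
    (GA : ∀ j : J, B9.KernelFamily (geo9Y (f j)) (codingYx G (f j) (C37 j) (C38 j)).bg)
    (Cinv : ∀ j : J, B9.SiteKernel (geo9Y (f j)) (codingYx G (f j) (C37 j) (C38 j)).bg) :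
    StepL2Pos dB c35 (fun j => geo9Y (f j)) (fun j => (codingYx G (f j) (C37 j) (C38 j)).bg) (fun j => KSC₃ G (f j) (par j) (C37 j) (C38 j)) GA Cinv
      (fun j => KSC₃ G (f j) (par j) (C37 j) (C38 j)) :=
  stepL2Pos_of_members (d := dB) (c35 := c35) (geo := fun j => geo9Y (f j)) (bg := fun j => (codingYx G (f j) (C37 j) (C38 j)).bg)
    (Gp := fun j => KSC₃ G (f j) (par j) (C37 j) (C38 j)) (GA := GA) (Cinv := Cinv) (fun j => modelSignsOn_geo9K (f j).toKIdx)
    fun n => stepL2nPos_KSC₃_on f c35 G b C37 C38 par ιB hι hG1 hpar hunit dB M₂ hM₂ hrepr hcR hcL Cq hCq hC37 MInv aInv aW hMInv haInv haW GA Cinv n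

end Literature.MathematicalPhysics.QuantumFieldTheory.Balaban1983to89.B9SectBL2StepCodedOn

end
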